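import Summits.FinalStateConjecture.FinalStateConjecture.Theorems.PhaseMixingCaptureBulkKerrCaptureC2CentreGaugeFamily
import Summits.FinalStateConjecture.FinalStateConjecture.Theorems.PhaseMixingCaptureBulkKerrCaptureC2SobolevFamilyLimit
import Mathlib.Analysis.Calculus.BumpFunction.InnerProduct
import Mathlib.Analysis.InnerProductSpace.Calculus
import Mathlib.Analysis.SpecialFunctions.Trigonometric.Deriv
import HarnessLib

/-!
# Crux `PhaseMixingCapture.BulkKerrCaptureC2` (stmt-FinalStateConjecture-14985): EVERY `ε`-ball of the crux
# contains competitors other than the centre on which the crux holds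

Support file, conclusion of the gauge-orbit sequence `…CentreGauge` (conclusion on the orbit, p149887),
`…CentreGaugeAdmissible` (all-orders finiteness, p152575), `…SobolevFamilyLimit` (compactly supported
smooth families tend to `0` in every `H^s_δ`, p153342), `…CentreGaugeFamily` (slice diffeomorphisms and
component families of an ambient gauge family; non-triviality by a shear, p154060).  Here the remaining
concrete input is built and everything is assembled (no definitions; the objects are produced
existentially):

* §1 `exists_axialRotations` — rotations about the `z`-axis of `E3 = ℝ³` as `cos θ • A + sin θ • J + B`
  (one-parameter group of isometries);
* §2 `exists_twistFamily` — for every `R ≥ 0` the **twist family** `Ψ t x = rot (t · g(‖x‖²)) x`,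
  `g(s) = (s - s₀) b(s)` with `b` a smooth bump at `s₀ = (R+2)²`: jointly smooth, `Ψ (-t) ∘ Ψ t = id`,
  `Ψ t = id` off a compact shell beyond radius `R`, `Ψ 0 = id`, and at `u = (R+2) e₀` (fixed by every
  `Ψ t`) the differential is the shear `DΨ_t(u) e₀ = e₀ + 2t(R+2)² e₁`, `DΨ_t(u) e₁ = e₁`;
* §3 **the witnesses**: with `R` the asymptotically flat radius of the Kerr–Schild slice (so that the shell
  lies in the slice, `Kerr.mem_slice_of_lt_norm`), the pulled-back data `Φ_t^* Kerr.data M a M` are, for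
  all small `t ≠ 0`, DIFFERENT from the centre and inside the `ε`-ball
  (`exists_gauge_offCentre_mem_ball`); combined with `cruxMatrix_gauge`:
  `exists_offCentre_cruxWitness` — **for every order `s`, weight `δ`, radius `ε > 0` and tolerance
  `η ≥ 0` there is a datum `D ≠ Kerr.data M a M` satisfying ALL hypotheses of the crux `BulkKerrCaptureC2`
  (vacuum constraints, finiteness at all orders, `ε`-closeness) for which the crux's conclusion holds for
  every maximal vacuum Cauchy development.**  So the crux is witnessed non-vacuously off the centre in
  every ball; a refutation must come from genuinely non-gauge (radiating) data, i.e. from the nonlinear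
  stability problem itself (`Literature.Geometry.Lorentzian.hintz_kerr_stability_subextremal_cauchy_allOrders`).

References: B. O'Neill, *Semi-Riemannian geometry* (1983), Ch. 3, Ch. 9; R. Bartnik, J. Isenberg, *The
constraint equations* (2004), §2; R. Bartnik, CPAM 39 (1986), §1.
-/

-- the doubled `FinalStateConjecture.FinalStateConjecture` path component trips dupNamespace
set_option linter.dupNamespace false

noncomputable section

open Set Filter Function Topology Metric TopologicalSpace
open scoped Manifold ContDiff Topology RealInnerProductSpace
open Literature.Geometry.Lorentzian

namespace Summit.FinalStateConjecture.FinalStateConjecture.Theorems.BulkKerrCaptureC2.Centre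

/-! ## §1 Rotations about the axis -/

/-- **Rotations about the `z`-axis of `ℝ³` as a one-parameter group of linear isometries**: there are
continuous linear maps `A`, `J`, `B` of `E3` (projection to the `xy`-plane, quarter turn of the
`xy`-plane, projection to the `z`-axis) with `A + B = id`, `J e₀ = e₁`, such that
`rot θ := cos θ • A + sin θ • J + B` satisfies `rot α ∘ rot β = rot (α + β)` and `‖rot θ x‖ = ‖x‖`.
O'Neill 1983, Ch. 9. [folklore] -/
theorem exists_axialRotations :
    ∃ A J B : E3 →L[ℝ] E3, (∀ x, A x + B x = x) ∧
      J (EuclideanSpace.single 0 1) = EuclideanSpace.single 1 1 ∧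
      (∀ x : E3, ⟪x, J x⟫ = 0) ∧
      (∀ α β x, Real.cos α • A (Real.cos β • A x + Real.sin β • J x + B x) +
          Real.sin α • J (Real.cos β • A x + Real.sin β • J x + B x) +
          B (Real.cos β • A x + Real.sin β • J x + B x) =
        Real.cos (α + β) • A x + Real.sin (α + β) • J x + B x) ∧
      ∀ θ x, ‖Real.cos θ • A x + Real.sin θ • J x + B x‖ = ‖x‖ := by
  let e : Fin 3 → E3 := fun i ↦ EuclideanSpace.single i 1
  let P : Fin 3 → E3 →L[ℝ] ℝ := fun i ↦ EuclideanSpace.proj i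
  refine ⟨(P 0).smulRight (e 0) + (P 1).smulRight (e 1), (P 0).smulRight (e 1) - (P 1).smulRight (e 0),
    (P 2).smulRight (e 2), ?_, ?_, ?_, ?_, ?_⟩
  · intro x
    ext i
    fin_cases i <;> simp [e, P]
  · ext i
    fin_cases i <;> simp [e, P]
  · intro x
    simp [e, P, PiLp.inner_apply, Fin.sum_univ_three]
    ring
  · intro α β x
    ext i
    fin_cases i <;> simp [e, P, Real.cos_add, Real.sin_add] <;> ring
  · intro θ x
    have h : ‖Real.cos θ • ((P 0).smulRight (e 0) + (P 1).smulRight (e 1)) x +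
        Real.sin θ • ((P 0).smulRight (e 1) - (P 1).smulRight (e 0)) x +
        ((P 2).smulRight (e 2)) x‖ ^ 2 = ‖x‖ ^ 2 := by
      rw [EuclideanSpace.real_norm_sq_eq, EuclideanSpace.real_norm_sq_eq, Fin.sum_univ_three,
        Fin.sum_univ_three]
      simp [e, P]
      have hcs := Real.cos_sq_add_sin_sq θ
      nlinarith [hcs]
    have h1 : 0 ≤ ‖Real.cos θ • ((P 0).smulRight (e 0) + (P 1).smulRight (e 1)) x +
        Real.sin θ • ((P 0).smulRight (e 1) - (P 1).smulRight (e 0)) x +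
        ((P 2).smulRight (e 2)) x‖ := norm_nonneg _
    nlinarith [norm_nonneg x, h, h1]


/-! ## §2 The twist family -/

/-- **The twist family beyond radius `R`** (an explicit ambient gauge family with a shear): see the
module docstring. The profile `g(s) = (s - s₀) b(s)` (`b` a smooth bump equal to `1` near
`s₀ = (R+2)²`, supported in `(s₀ - 1, s₀ + 1)`) vanishes at `s₀` with `g'(s₀) = 1`, so the sphere
`‖x‖ = R + 2` is fixed pointwise while the differential there is the shear
`v ↦ v + 2t⟪u, v⟫ J u`. [folklore] -/
theorem exists_twistFamily (R : ℝ) (hR : 0 ≤ R) :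
    ∃ (Ψ : ℝ → E3 → E3) (S : Set E3) (u w : E3) (c : ℝ → ℝ),
      ContDiff ℝ ∞ (uncurry Ψ) ∧ (∀ t x, Ψ (-t) (Ψ t x) = x) ∧ IsCompact S ∧
      S ⊆ {x | R < ‖x‖} ∧ (∀ t x, x ∉ S → Ψ t x = x) ∧ (∀ x, Ψ 0 x = x) ∧ R < ‖u‖ ∧
      (∀ t, Ψ t u = u) ∧
      (∀ t, fderiv ℝ (Ψ t) u (EuclideanSpace.single 0 1) = EuclideanSpace.single 0 1 + c t • w) ∧
      (∀ t, fderiv ℝ (Ψ t) u w = w) ∧ w ≠ 0 ∧ ∀ t, t ≠ 0 → c t ≠ 0 := by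
  obtain ⟨A, J, B, hAB, hJe, -, hgrp, hnorm⟩ := exists_axialRotations
  -- the profile `g`, the angle function `χ`, the rotations and the family
  set s₀ : ℝ := (R + 2) ^ 2 with hs₀
  let bmp : ContDiffBump s₀ := ⟨1 / 2, 1, by norm_num, by norm_num⟩
  let g : ℝ → ℝ := fun s ↦ (s - s₀) * bmp s
  let χ : E3 → ℝ := fun x ↦ g (‖x‖ ^ 2)
  let rot : ℝ → E3 → E3 := fun θ x ↦ Real.cos θ • A x + Real.sin θ • J x + B x
  let Ψ : ℝ → E3 → E3 := fun t x ↦ rot (t * χ x) x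
  let S : Set E3 := (fun x : E3 ↦ ‖x‖ ^ 2) ⁻¹' Icc (s₀ - 1) (s₀ + 1)
  let e₀ : E3 := EuclideanSpace.single 0 1
  let e₁ : E3 := EuclideanSpace.single 1 1
  let u : E3 := (R + 2) • e₀
  -- smoothness
  have hg_smooth : ContDiff ℝ ∞ g := (contDiff_id.sub contDiff_const).mul bmp.contDiff
  have hχ_smooth : ContDiff ℝ ∞ χ := hg_smooth.comp (contDiff_norm_sq ℝ)
  have hΨ_smooth : ContDiff ℝ ∞ (uncurry Ψ) := by
    have hθ : ContDiff ℝ ∞ fun p : ℝ × E3 ↦ p.1 * χ p.2 :=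
      contDiff_fst.mul (hχ_smooth.comp contDiff_snd)
    exact (((Real.contDiff_cos.comp hθ).smul (A.contDiff.comp contDiff_snd)).add
      ((Real.contDiff_sin.comp hθ).smul (J.contDiff.comp contDiff_snd))).add
      (B.contDiff.comp contDiff_snd)
  -- elementary identities
  have hrot0 : ∀ x, rot 0 x = x := fun x ↦ by simp [rot, hAB]
  have hrot_add : ∀ α β x, rot α (rot β x) = rot (α + β) x := fun α β x ↦ hgrp α β x
  have hrot_norm : ∀ θ x, ‖rot θ x‖ = ‖x‖ := fun θ x ↦ hnorm θ x
  have hχ_rot : ∀ θ x, χ (rot θ x) = χ x := fun θ x ↦ by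
    simp only [χ, hrot_norm]
  have hg0 : g s₀ = 0 := by simp [g]
  have hg_off : ∀ s, s ∉ Icc (s₀ - 1) (s₀ + 1) → g s = 0 := by
    intro s hs
    have hb : bmp s = 0 := by
      apply bmp.zero_of_le_dist
      simp only [mem_Icc, not_and_or, not_le] at hs
      show (1 : ℝ) ≤ dist s s₀
      rw [Real.dist_eq]
      rcases hs with h | h
      · rw [abs_of_neg (by linarith)]
        linarith
      · rw [abs_of_pos (by linarith)]
        linarith
    simp [g, hb]
  have hχ_off : ∀ x, x ∉ S → χ x = 0 := fun x hx ↦ hg_off _ hx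
  -- the point `u`
  have hu_norm : ‖u‖ = R + 2 := by
    rw [norm_smul, Real.norm_of_nonneg (by linarith), PiLp.norm_single, norm_one, mul_one]
  have hu_sq : ‖u‖ ^ 2 = s₀ := by rw [hu_norm]
  have hχu : χ u = 0 := by simp only [χ, hu_sq, hg0]
  have hinner₀ : ⟪u, e₀⟫ = R + 2 := by
    rw [inner_smul_left, EuclideanSpace.inner_single_left]
    simp [e₀]
  have hinner₁ : ⟪u, e₁⟫ = 0 := by
    rw [inner_smul_left, EuclideanSpace.inner_single_left]
    simp [e₁]
  have hJu : J u = (R + 2) • e₁ := by rw [map_smul, hJe]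
  -- the differential of `Ψ t` at `u`
  have hderiv : ∀ t v, fderiv ℝ (Ψ t) u v = v + (t * (2 * ⟪u, v⟫)) • J u := by
    intro t v
    have hg' : HasDerivAt g 1 s₀ := by
      have hev : g =ᶠ[𝓝 s₀] fun s ↦ s - s₀ :=
        bmp.eventuallyEq_one.mono fun s hs ↦ by simp [g, hs]
      exact ((hasDerivAt_id s₀).sub_const s₀).congr_of_eventuallyEq hev
    have hg'' : HasDerivAt g 1 (‖u‖ ^ 2) := by rw [hu_sq]; exact hg'
    have hχ' : HasFDerivAt χ ((1 : ℝ) • ((2 : ℕ) • innerSL ℝ u)) u := by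
      have h := hg''.comp_hasFDerivAt u (hasStrictFDerivAt_norm_sq u).hasFDerivAt
      exact h
    have hθ' : HasFDerivAt (fun x ↦ t * χ x) (t • ((1 : ℝ) • ((2 : ℕ) • innerSL ℝ u))) u :=
      hχ'.const_mul t
    have hcos : HasFDerivAt (fun x ↦ Real.cos (t * χ x))
        (-Real.sin (t * χ u) • (t • ((1 : ℝ) • ((2 : ℕ) • innerSL ℝ u)))) u :=
      (Real.hasDerivAt_cos _).comp_hasFDerivAt u hθ'
    have hsin : HasFDerivAt (fun x ↦ Real.sin (t * χ x))
        (Real.cos (t * χ u) • (t • ((1 : ℝ) • ((2 : ℕ) • innerSL ℝ u)))) u :=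
      (Real.hasDerivAt_sin _).comp_hasFDerivAt u hθ'
    have h1 := hcos.smul A.hasFDerivAt
    have h2 := hsin.smul J.hasFDerivAt
    have hΨ' : HasFDerivAt (Ψ t) _ u := (h1.add h2).add B.hasFDerivAt
    rw [hΨ'.fderiv]
    simp only [hχu, mul_zero, Real.cos_zero, Real.sin_zero, neg_zero, one_smul, zero_smul,
      add_apply, ContinuousLinearMap.smulRight_apply, smul_apply, zero_apply, innerSL_apply_apply,
      smul_eq_mul, nsmul_eq_mul, Nat.cast_ofNat, zero_add, add_zero]
    rw [show A v + (t * (2 * ⟪u, v⟫)) • J u + B v = (A v + B v) + (t * (2 * ⟪u, v⟫)) • J u by abel,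
      hAB]
  refine ⟨Ψ, S, u, e₁, fun t ↦ 2 * t * (R + 2) ^ 2, hΨ_smooth, ?_, ?_, ?_, ?_, ?_, ?_, ?_, ?_, ?_,
    ?_, ?_⟩
  · -- inverse
    intro t x
    show rot (-t * χ (rot (t * χ x) x)) (rot (t * χ x) x) = x
    rw [hχ_rot, hrot_add, show -t * χ x + t * χ x = 0 by ring, hrot0]
  · -- compactness of the shell
    have hclosed : IsClosed S := isClosed_Icc.preimage (continuous_norm.pow 2)
    refine (isCompact_closedBall (0 : E3) (s₀ + 2)).of_isClosed_subset hclosed fun x hx ↦ ?_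
    rw [mem_closedBall, dist_zero_right]
    have hx2 : ‖x‖ ^ 2 ≤ s₀ + 1 := hx.2
    nlinarith [norm_nonneg x, sq_nonneg (‖x‖ - 1)]
  · -- the shell lies beyond `R`
    intro x hx
    have hx1 : s₀ - 1 ≤ ‖x‖ ^ 2 := hx.1
    have hR2 : R ^ 2 < ‖x‖ ^ 2 := by rw [hs₀] at hx1; nlinarith
    exact lt_of_pow_lt_pow_left₀ 2 (norm_nonneg x) hR2
  · -- identity off the shell
    intro t x hx
    show rot (t * χ x) x = x
    rw [hχ_off x hx, mul_zero, hrot0]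
  · intro x
    show rot (0 * χ x) x = x
    rw [zero_mul, hrot0]
  · rw [hu_norm]
    linarith
  · intro t
    show rot (t * χ u) u = u
    rw [hχu, mul_zero, hrot0]
  · intro t
    rw [hderiv, hinner₀, hJu, smul_smul]
    congr 1
    ring_nf
  · intro t
    rw [hderiv, hinner₁, mul_zero, mul_zero, zero_smul, add_zero]
  · simp [e₁]
  · intro t ht
    have h2 : (R + 2) ^ 2 ≠ 0 := pow_ne_zero 2 (by linarith)
    exact mul_ne_zero (mul_ne_zero two_ne_zero ht) h2


/-! ## §3 The witnesses: gauge competitors off the centre inside every `ε`-ball of the crux -/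

section Ball

variable {M a : ℝ} [Kerr.Facts] [Kerr.SliceFacts]

/-- **Every `ε`-ball about the centre contains a gauge competitor other than the centre**: for every
order `s`, weight `δ` and `ε > 0` there is a diffeomorphism `Φ` of the Kerr–Schild slice (smooth,
injective differentials, the identity off a compact set) with `Φ^* Kerr.data M a M ≠ Kerr.data M a M` and
`dist_{H^s_δ × H^{s-1}_{δ+1}}(Φ^* Kerr.data, Kerr.data) < ε` — the twist family beyond the asymptotically
flat radius, at a small nonzero parameter (`eventually_dataWeightedSobolevEDist_lt`, `comap_ne_of_shear`).
[folklore] -/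
theorem exists_gauge_offCentre_mem_ball (hM : 0 ≤ M) (s : ℕ) (δ : ℝ) {ε : ℝ} (hε : 0 < ε) :
    ∃ (Φ : Kerr.slice a M ≃ₜ Kerr.slice a M) (hΦ : ContMDiff (𝓡 3) (𝓡 3) (∞ + 1) Φ)
      (hΦ' : ∀ u, Injective (mfderiv (𝓡 3) (𝓡 3) Φ u)) (K₀ : Set (Kerr.slice a M)),
      IsCompact K₀ ∧ (∀ y, y ∉ K₀ → Φ y = y) ∧
      (Kerr.data M a M hM).comap Φ hΦ hΦ' ≠ Kerr.data M a M hM ∧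
      InitialDataSet.dataWeightedSobolevEDist s δ ((Kerr.data M a M hM).comap Φ hΦ hΦ')
        (Kerr.data M a M hM) < ENNReal.ofReal ε := by
  obtain ⟨Ψ, S, u, w, c, hΨs, hinv, hS, hSR, hfix, h0, huR, hu, hDv, hDw, hw0, hc⟩ :=
    exists_twistFamily (Kerr.afRadius a M) (Kerr.afRadius_pos a M).le
  have hSU : S ⊆ (Kerr.slice a M : Set E3) := fun x hx ↦ Kerr.mem_slice_of_lt_norm (hSR hx)
  have huU : u ∈ (Kerr.slice a M : Set E3) := Kerr.mem_slice_of_lt_norm huR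
  -- the slice diffeomorphisms of the family
  choose Φ hΦrepr _hΦsymm using
    fun t ↦ exists_sliceHomeomorph (U := Kerr.slice a M) hΨs.continuous hinv hfix hSU t
  have hsm : ∀ t, ContDiff ℝ ∞ (Ψ t) := fun t ↦ hΨs.comp (contDiff_prodMk_right t)
  have hd : ∀ t x, DifferentiableAt ℝ (Ψ t) x := fun t x ↦ (hsm t).differentiable (by simp) x
  have hΦ : ∀ t, ContMDiff (𝓡 3) (𝓡 3) (∞ + 1) (Φ t) := fun t ↦
    contMDiff_of_repr' (hΦrepr t) (hsm t)
  have hΦ' : ∀ t y, Injective (mfderiv (𝓡 3) (𝓡 3) (Φ t) y) := fun t ↦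
    injective_mfderiv_of_repr (hΦrepr t) hd hinv
  -- the pulled-back data are eventually inside the ball …
  have hev := eventually_dataWeightedSobolevEDist_lt
    (fun t ↦ (Kerr.data M a M hM).comap (Φ t) (hΦ t) (hΦ' t)) (Kerr.data M a M hM)
    (contDiff_hFun_family (Kerr.data M a M hM) (fun t ↦ (Φ t : Kerr.slice a M → Kerr.slice a M))
      hΦrepr hΦ hΦ' hΨs hinv hS hSU hfix)
    (contDiff_kFun_family (Kerr.data M a M hM) (fun t ↦ (Φ t : Kerr.slice a M → Kerr.slice a M))
      hΦrepr hΦ hΦ' hΨs hinv hS hSU hfix)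
    hS
    (support_hFun_family_subset (Kerr.data M a M hM)
      (fun t ↦ (Φ t : Kerr.slice a M → Kerr.slice a M)) hΦrepr hΦ hΦ' hS hSU hfix)
    (support_kFun_family_subset (Kerr.data M a M hM)
      (fun t ↦ (Φ t : Kerr.slice a M → Kerr.slice a M)) hΦrepr hΦ hΦ' hS hSU hfix)
    (comap_family_zero (Kerr.data M a M hM) (fun t ↦ (Φ t : Kerr.slice a M → Kerr.slice a M))
      hΦrepr hΦ hΦ' h0) s δ hε
  -- … so there is a nonzero parameter with the datum inside the ball
  obtain ⟨t, ht, ht0⟩ :=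
    ((hev.filter_mono nhdsWithin_le_nhds).and (self_mem_nhdsWithin (s := {(0 : ℝ)}ᶜ))).exists
  -- and at a nonzero parameter the datum differs from the centre (shear at the fixed point `u`)
  have hfixu : Φ t ⟨u, huU⟩ = ⟨u, huU⟩ := Subtype.ext ((hΦrepr t _).trans (hu t))
  have hne : (Kerr.data M a M hM).comap (Φ t) (hΦ t) (hΦ' t) ≠ Kerr.data M a M hM :=
    comap_ne_of_shear (Kerr.data M a M hM) (Φ t) (hΦ t) (hΦ' t) (hΦrepr t) (hd t u) hfixu (hDv t)
      (hDw t) hw0 (hc t ht0)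
  exact ⟨Φ t, hΦ t, hΦ' t, Subtype.val ⁻¹' S, isCompact_preimage_val hS hSU,
    fun y hy ↦ fix_of_repr (hΦrepr t) hfix y hy, hne, ht⟩

/-- **The crux is witnessed off the centre in every ball.**  For sub-extremal `|a| < M`, every order `s`,
weight `δ`, radius `ε > 0` and tolerance `η ≥ 0`, there is an initial data set `D ≠ Kerr.data M a M` on the
Kerr–Schild slice such that: `D` solves the vacuum constraints; `dist_{s',δ}(D, Kerr.data M a M) < ∞`
for EVERY `s'`; `dist_{s,δ}(D, Kerr.data M a M) < ε`; and every maximal vacuum Cauchy development of `D`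
has far-complete `𝓘⁺` and converges in `C²` to a sub-extremal `g_{M',a'}` with `|M'-M| + |a'-a| ≤ η` —
i.e. `D` meets all hypotheses of the crux `BulkKerrCaptureC2` and its conclusion (the gauge competitor of
`exists_gauge_offCentre_mem_ball`, with `cruxMatrix_gauge`). [folklore] -/
theorem exists_offCentre_cruxWitness (hM : 0 < M) (ha : |a| < M) (s : ℕ) (δ : ℝ) {ε : ℝ}
    (hε : 0 < ε) {η : ℝ} (hη : 0 ≤ η) :
    ∃ D : InitialDataSet 𝓘(ℝ, E3) (Kerr.slice a M), D ≠ Kerr.data M a M hM.le ∧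
      (∀ [D.metric.HasLeviCivita], D.IsVacuumConstraintSolution) ∧
      (∀ s' : ℕ, InitialDataSet.dataWeightedSobolevEDist s' δ D (Kerr.data M a M hM.le) < ⊤) ∧
      InitialDataSet.dataWeightedSobolevEDist s δ D (Kerr.data M a M hM.le) < ENNReal.ofReal ε ∧
      ∀ 𝒟 : VacuumCauchyDevelopment D, 𝒟.IsMaximal →
        ∃ (M' a' : ℝ) (𝒟oc : Set 𝒟.carrier), Kerr.IsSubextremal M' a' ∧
          𝒟.HasCompleteFutureNullInfinityFar ∧ 𝒟.toSpacetime.ConvergesToKerr 𝒟oc M' a' 2 ∧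
          |M' - M| + |a' - a| ≤ η := by
  obtain ⟨Φ, hΦ, hΦ', K₀, hK₀, hfix, hne, hlt⟩ := exists_gauge_offCentre_mem_ball (a := a) hM.le s δ hε
  obtain ⟨hvac, hfin, hconc⟩ := cruxMatrix_gauge hM ha hη Φ hΦ hΦ' hK₀ hfix δ
  exact ⟨_, hne, hvac, hfin, hlt, hconc⟩

end Ball


/-- Registered stub `stub_offCentre_cruxWitness` of the crux item (verbatim signature): the statement
of `exists_offCentre_cruxWitness` with all binders explicit. [folklore] -/
theorem stub_offCentre_cruxWitness : ∀ [Kerr.Facts] [Kerr.SliceFacts] (M : ℝ) (hM : 0 < M) (a : ℝ), |a| < M → ∀ (s : ℕ) (δ ε : ℝ), 0 < ε → ∀ η : ℝ, 0 ≤ η → ∃ D : InitialDataSet 𝓘(ℝ, E3) (Kerr.slice a M), D ≠ Kerr.data M a M hM.le ∧ (∀ [D.metric.HasLeviCivita], D.IsVacuumConstraintSolution) ∧ (∀ s' : ℕ, InitialDataSet.dataWeightedSobolevEDist s' δ D (Kerr.data M a M hM.le) < ⊤) ∧ InitialDataSet.dataWeightedSobolevEDist s δ D (Kerr.data M a M hM.le)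 < ENNReal.ofReal ε ∧ ∀ 𝒟 : VacuumCauchyDevelopment D, 𝒟.IsMaximal → ∃ (M' a' : ℝ) (𝒟oc : Set 𝒟.carrier), Kerr.IsSubextremal M' a' ∧ 𝒟.HasCompleteFutureNullInfinityFar ∧ 𝒟.toSpacetime.ConvergesToKerr 𝒟oc M' a' 2 ∧ |M' - M| + |a' - a| ≤ η :=
  fun _ hM _ ha s δ _ hε _ hη ↦ exists_offCentre_cruxWitness hM ha s δ hε hη

end Summit.FinalStateConjecture.FinalStateConjecture.Theorems.BulkKerrCaptureC2.Centre
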